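import Literature.Probability.RandomPlanarGeometry.HalfPlaneGreenFunction
import HarnessLib

/-!
# The Green potential of a planar domain: continuity up to the boundary

Topic `Literature/Probability/RandomPlanarGeometry` (potential theory of planar domains through a
conformal map onto `ℍ`, continuing `HalfPlaneGreenFunction.lean`; continuum input of the discharge
of `Literature.Probability.LatticeModels.Kenyon2000_flatEdgePoissonKernelLimit`).

For `Ω` open, `w` holomorphic and injective on `Ω` with `w(Ω) = ℍ`, `u ∈ Ω`, `b = w u`, put
`Φ(z) = (2π)⁻¹ log ‖z - u‖` (logarithmic potential of the pole),
`g(z) = (2π)⁻¹ log (‖w z - conj b‖/‖w z - b‖)` (Green function) and consider any `f : ℂ → ℝ`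
with `f = (2π)⁻¹ log ‖(w · - conj b)/dslope w u ·‖` on `Ω` and `f = Φ` on `frontier Ω` (the
"Green potential", harmonic on `Ω` by `harmonicOnNhd_greenPotential`). PROVED here:

* `green_nonneg` — `g ≥ 0` on `Ω`;
* `tendsto_green_nhdsWithin_frontier` — `g(z) → 0` as `z → ζ ∈ frontier Ω` inside `Ω`;
* `continuousAt_logPotential` — `Φ` is continuous off `u`;
* **`continuousOn_greenDirichlet`** — `f` is continuous on `closure Ω`;
* **`harmonicOnNhd_greenDirichlet`** — `f` is harmonic on `Ω`.

Everything is proved, [folklore]; no named fact.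

## References

* R. Kenyon, *Conformal invariance of domino tiling*, Ann. Probab. 28 (2000), §5.3 [Kenyon2000].
* L. V. Ahlfors, *Complex Analysis*, 3rd ed. (1979), Ch. 6 §5 [AhlforsCA1979].
-/

noncomputable section

namespace Literature.Probability.RandomPlanarGeometry

open Set Metric Complex Filter _root_.Topology ComplexConjugate InnerProductSpace

/-- The Green function is nonnegative: `‖w z - conj b‖ ≥ ‖w z - b‖` for `w z, b ∈ ℍ`. [folklore] -/
theorem green_nonneg {Ω : Set ℂ} {w : ℂ → ℂ} (hbij : BijOn w Ω {z : ℂ | 0 < z.im}) {u : ℂ}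
    (hu : u ∈ Ω) {z : ℂ} (hz : z ∈ Ω) :
    0 ≤ (2 * Real.pi)⁻¹ * Real.log (‖w z - conj (w u)‖ / ‖w z - w u‖) := by
  have h1 : 0 < (w z).im := hbij.mapsTo hz
  have h2 : 0 < (w u).im := hbij.mapsTo hu
  have hle : ‖w z - w u‖ ≤ ‖w z - conj (w u)‖ := by
    refine (pow_le_pow_iff_left₀ (norm_nonneg _) (norm_nonneg _) two_ne_zero).1 ?_
    rw [← normSq_eq_norm_sq, ← normSq_eq_norm_sq]
    have := normSq_sub_conj_sub (w z) (w u)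
    nlinarith
  by_cases h0 : ‖w z - w u‖ = 0
  · rw [h0, div_zero, Real.log_zero, mul_zero]
  · refine mul_nonneg (by positivity) (Real.log_nonneg ?_)
    rw [le_div_iff₀ (lt_of_le_of_ne (norm_nonneg _) (Ne.symm h0)), one_mul]
    exact hle

/-- **The Green function tends to `0` at the boundary**: for `ζ ∈ frontier Ω` (so `ζ ∉ Ω`),
`g(z) → 0` as `z → ζ` within `Ω` (`exists_isCompact_green_lt` and `g ≥ 0`). [folklore] -/
theorem tendsto_green_nhdsWithin_frontier {Ω : Set ℂ} (hΩ : IsOpen Ω) {w : ℂ → ℂ}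
    (hw : DifferentiableOn ℂ w Ω) (hbij : BijOn w Ω {z : ℂ | 0 < z.im}) {u : ℂ} (hu : u ∈ Ω)
    {ζ : ℂ} (hζ : ζ ∉ Ω) :
    Tendsto (fun z => (2 * Real.pi)⁻¹ * Real.log (‖w z - conj (w u)‖ / ‖w z - w u‖))
      (𝓝[Ω] ζ) (𝓝 0) := by
  rw [Metric.tendsto_nhds]
  intro ε hε
  obtain ⟨K, hKc, hKΩ, hK⟩ := exists_isCompact_green_lt hΩ hw hbij hu hε
  have hζK : ζ ∉ K := fun h => hζ (hKΩ h)
  have hKev : ∀ᶠ z in 𝓝 ζ, z ∉ K := hKc.isClosed.isOpen_compl.eventually_mem hζK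
  filter_upwards [mem_nhdsWithin_of_mem_nhds hKev, self_mem_nhdsWithin] with z hzK hzΩ
  rw [Real.dist_eq, sub_zero, abs_of_nonneg (green_nonneg hbij hu hzΩ)]
  exact hK z hzΩ hzK

/-- The logarithmic potential `Φ(z) = (2π)⁻¹ log ‖z - u‖` is continuous off the pole. [folklore] -/
theorem continuousAt_logPotential {u z : ℂ} (hzu : z ≠ u) :
    ContinuousAt (fun z => (2 * Real.pi)⁻¹ * Real.log ‖z - u‖) z := by
  have h1 : ContinuousAt (fun z : ℂ => ‖z - u‖) z := (continuous_id.sub continuous_const).norm.continuousAt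
  have h2 : ContinuousAt (fun z : ℂ => Real.log ‖z - u‖) z :=
    h1.log (by simpa [sub_eq_zero] using hzu)
  exact continuousAt_const.mul h2

/-- **The Green potential is continuous on the closure.** Let `f = (2π)⁻¹ log ‖(w - conj b)/dslope w u‖`
on `Ω` and `f = Φ` on `frontier Ω`. Then `f` is continuous on `closure Ω`: inside by harmonicity,
at the frontier because `f = Φ + g` on `Ω ∖ {u}` with `g → 0` there and `Φ` continuous.
[folklore] -/
theorem continuousOn_greenDirichlet {Ω : Set ℂ} (hΩ : IsOpen Ω) {w : ℂ → ℂ}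
    (hw : DifferentiableOn ℂ w Ω) (hbij : BijOn w Ω {z : ℂ | 0 < z.im}) {u : ℂ} (hu : u ∈ Ω)
    {f : ℂ → ℝ}
    (hfΩ : ∀ z ∈ Ω, f z = (2 * Real.pi)⁻¹ * Real.log ‖(w z - conj (w u)) / dslope w u z‖)
    (hfb : ∀ z ∈ frontier Ω, f z = (2 * Real.pi)⁻¹ * Real.log ‖z - u‖) :
    ContinuousOn f (closure Ω) := by
  intro ζ hζ
  by_cases hζΩ : ζ ∈ Ω
  · -- interior point: `f` agrees with the harmonic Green potential near `ζ`
    have hharm := harmonicOnNhd_greenPotential hΩ hw hbij hu ζ hζΩ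
    have hcont : ContinuousAt
        (fun z => (2 * Real.pi)⁻¹ * Real.log ‖(w z - conj (w u)) / dslope w u z‖) ζ :=
      hharm.1.continuousAt
    have heq : (fun z => (2 * Real.pi)⁻¹ * Real.log ‖(w z - conj (w u)) / dslope w u z‖) =ᶠ[𝓝 ζ] f := by
      filter_upwards [hΩ.mem_nhds hζΩ] with z hz
      exact (hfΩ z hz).symm
    exact (hcont.congr heq).continuousWithinAt
  · -- frontier point
    have hζf : ζ ∈ frontier Ω := by
      rw [frontier, hΩ.interior_eq]; exact ⟨hζ, hζΩ⟩
    have hζu : ζ ≠ u := fun h => hζΩ (h ▸ hu)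
    have hΦ : Tendsto (fun z => (2 * Real.pi)⁻¹ * Real.log ‖z - u‖) (𝓝 ζ) (𝓝 (f ζ)) := by
      rw [hfb ζ hζf]; exact (continuousAt_logPotential hζu).tendsto
    show Tendsto f (𝓝[closure Ω] ζ) (𝓝 (f ζ))
    rw [closure_eq_self_union_frontier, nhdsWithin_union]
    refine Tendsto.sup ?_ ?_
    · -- from inside: `f = Φ + g`, `g → 0`
      have hg := tendsto_green_nhdsWithin_frontier hΩ hw hbij hu hζΩ
      have hsum := (hΦ.mono_left nhdsWithin_le_nhds).add hg
      rw [add_zero] at hsum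
      refine hsum.congr' ?_
      have hne : ∀ᶠ z in 𝓝[Ω] ζ, z ≠ u :=
        mem_nhdsWithin_of_mem_nhds (isOpen_ne.mem_nhds hζu)
      filter_upwards [hne, self_mem_nhdsWithin] with z hzu hzΩ
      rw [hfΩ z hzΩ, greenPotential_eq hbij hu hzΩ hzu, add_comm]
    · -- along the frontier: `f = Φ`
      refine (hΦ.mono_left nhdsWithin_le_nhds).congr' ?_
      filter_upwards [self_mem_nhdsWithin] with z hz
      exact (hfb z hz).symm

/-- **The Green potential is harmonic on `Ω`.** [folklore] -/
theorem harmonicOnNhd_greenDirichlet {Ω : Set ℂ} (hΩ : IsOpen Ω) {w : ℂ → ℂ}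
    (hw : DifferentiableOn ℂ w Ω) (hbij : BijOn w Ω {z : ℂ | 0 < z.im}) {u : ℂ} (hu : u ∈ Ω)
    {f : ℂ → ℝ}
    (hfΩ : ∀ z ∈ Ω, f z = (2 * Real.pi)⁻¹ * Real.log ‖(w z - conj (w u)) / dslope w u z‖) :
    HarmonicOnNhd f Ω := by
  intro ζ hζ
  have hharm := harmonicOnNhd_greenPotential hΩ hw hbij hu ζ hζ
  refine (harmonicAt_congr_nhds ?_).1 hharm
  filter_upwards [hΩ.mem_nhds hζ] with z hz
  exact (hfΩ z hz).symm

end Literature.Probability.RandomPlanarGeometry
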